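import Summits.Ventures.YMGap.RobustBall.BoundaryStateMarginal
import Summits.Ventures.YMGap.RobustBall.BoundaryEntropyDensity
import Summits.Ventures.YMGap.RobustBall.BoundaryVanHoveLimit
import HarnessLib

/-!
# Venture YMGap, track ROBUST-BALL — «C-ENT-μ»: THE RELATIVE ENTROPY OF THE INFINITE-VOLUME DLR STATE ON A FINITE REGION, AND ITS DENSITY —
# the specific entropy of THE strong-coupling `SU(2)` Yang–Mills state exists along every van Hove sequence and equals `−b(2 − u(b)) − f(b)/6`

HONEST FRAMING. WHAT THIS IS: a venture file (cell `pub-ymgap`, track Y2 ROBUST-BALL / DS, seat ds-3, theorems only, 0 compute): the `SU(2)`,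
`d = 4` cells of «C-ENT-μ» on the vertex-star window `0 ≤ β_W ≤ 9/25` (tree `0 ≤ b ≤ 9/50`), from the generic half `BoundaryStateMarginal`
(marginal = mixture of inner Gibbs laws, Jensen, variational lower bound), the entropy form of «C-DS-I» (`BoundaryEntropyDensity`), «C-DS-I»
itself and the van Hove budget lemma (`BoundaryVanHoveLimit`). `μ` THE DLR state at `b` (unique, axis symmetric), `u(b) = μ(Re tr U_{p₀})`,
`f = freeEnergyDensity 4 ρ₂`, `μ|_Λ` the marginal on the links of `Λ`, `∂T(Λ) = {p ∈ T(Λ) : p ⊄ Λ}`: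
* ★★★ `su2_abs_klDiv_state_restrict_sub_le` — for every finite `Λ` with depth data `(φ, m)`:
  `|KL(μ|_Λ ‖ Haar_Λ) − #T(Λ)·(−b(2 − u(b)) − f(b)/6)| ≤ 2b·Σ_{p∈T(Λ)} min 4 (1024√2·e^{−κ₁(R_G(2b))⌊m_p/4⌋}) + 4b·#∂T(Λ)`;
* ★★ `su2_abs_klDiv_state_restrict_div_sub_le_of_depth` — VAN HOVE FORM per plaquette, arbitrary shapes (`K ≥ 1`):
  `|KL(μ|_Λ ‖ Haar_Λ)/#T(Λ) − (−b(2 − u) − f/6)| ≤ 2b·(1024√2·e^{−κ₁K} + 6·#{p ∈ T(Λ) : m_p < 4K}/#T(Λ))`;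
* ★★★ `su2_klDiv_state_restrict_div_vanHove_tendsto` — THE SPECIFIC RELATIVE ENTROPY OF THE INFINITE-VOLUME STATE EXISTS along every van Hove
  sequence with depth data and equals `−b(2 − u(b)) − f(b)/6` (minus Boltzmann's specific entropy relative to Haar: `s = b·e + p` with `e = 2 − u`
  the mean plaquette energy and `p = f/6` the pressure per plaquette) for THE DLR state of `SU(2)` lattice Yang–Mills at strong coupling.
* ★★★ `su2_toReal_klDiv_state_restrict_inner_law_le` — INFORMATION GAIN ZERO, SURFACE FORM: for EVERY boundary field `η`,
  `KL(μ|_Λ ‖ π_Λ^{b,η}) ≤ 3b·Σ_{p∈T(Λ)} min 4 (…) + 4b·#∂T(Λ)` — NO volume term (entropy, energy and free energy cancel exactly): the specific relative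
  entropy of THE state with respect to the finite-volume Gibbs laws with ANY boundary conditions VANISHES (`…_div_le_of_depth`: per plaquette
  `≤ b·(3·1024√2·e^{−κ₁K} + 16·(shallow fraction))`) — the "h(μ | γ) = 0" half of the Lanford–Ruelle variational principle, quantitatively.
WHAT THIS IS NOT: lattice strong coupling; relative entropy w.r.t. product Haar / inner Gibbs laws on finite regions (no infinite-volume entropy functional on
translation-invariant states is defined here); nothing about the continuum limit or Clay. Everything here is proved. [folklore]
References: O. E. Lanford, D. W. Robinson, J. Math. Phys. 9 (1968) 1120 (mean entropy); H.-O. Georgii, *Gibbs Measures and Phase Transitions*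
(2011), Ch. 15 (specific entropy, variational principle) — statement shapes only.
-/

noncomputable section

open MeasureTheory ProbabilityTheory InformationTheory Filter Topology Real Finset Set
open scoped NNReal ENNReal
open Literature.Probability.LatticeModels hiding configShift configShift_apply
open Literature.MathematicalPhysics.QuantumLattice
open Literature.MathematicalPhysics.QuantumFieldTheory (haarProbability)
open Summit.Ventures.YMGap.StarWindowGauge (gaugeR gaugeR_lt_one_of_le)
open Summit.Ventures.YMGap.StarLemmaG (gaugeR_nonneg)

namespace Summit.Ventures.YMGap.RobustBall

namespace BoundaryFreeEnergy

/-! ### Part C — `SU(2)` on `ℤ⁴`, EVERY `0 ≤ β_W ≤ 9/25`: the relative entropy of THE DLR state's marginals, and its density -/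

section SU2

/-- ★★★ **THE RELATIVE ENTROPY OF THE INFINITE-VOLUME STATE ON A FINITE REGION = VOLUME × DENSITY ± SURFACE** (`SU(2)`, `d = 4`, tree coupling
`0 ≤ b ≤ 9/50`; `μ` THE DLR state at `b`, `u(b) = μ(Re tr U_{p₀})`; finite `Λ` with depth data `(φ, m)`; `∂T(Λ) = {p ∈ T(Λ) : p ⊄ Λ}`):
`|KL(μ|_Λ ‖ Haar_Λ) − #T(Λ)·(−b(2 − u(b)) − f(b)/6)| ≤ 2b·Σ_{p∈T(Λ)} min 4 (1024√2·e^{−κ₁(R_G(2b))⌊m_p/4⌋}) + 4b·#∂T(Λ)` — Jensen under the DLR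
mixture for the upper bound, the variational inequality + «C-DS-I» for the lower bound. [folklore] -/
theorem su2_abs_klDiv_state_restrict_sub_le {b : ℝ} (hb0 : 0 ≤ b) (hb : b ≤ 9 / 50)
    {μ : Measure (LGConfig 4 (SUN 2))} (hμ : μ ∈ ymGibbsMeasures (d := 4) (fundamentalRep (Fin 2)) b)
    (Λ : Finset (ZdEdge 4)) (φ : ZdEdge 4 → ℝ) (hφ : ∀ x y : ZdEdge 4, φ x ≤ φ y + ‖x.1 - y.1‖) (hφΛ : ∀ x, 0 < φ x → x ∈ Λ)
    (m : ZdPlaquette 4 → ℝ) (hm : ∀ p ∈ plaquettesTouching Λ, ∀ x ∈ plaquetteEdges p, m p ≤ φ x) :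
    |(klDiv (μ.map (fun U (e : ↥Λ) => U e)) (Measure.pi fun _ : ↥Λ => haarProbability (SUN 2))).toReal -
        (plaquettesTouching Λ).card *
          (-b * ((2 : ℝ) - ∫ U, plaquetteObs (fundamentalRep (Fin 2)) 0 0 1 U ∂μ) - freeEnergyDensity 4 (fundamentalRep (Fin 2)) b / 6)| ≤
      2 * b * ∑ p ∈ plaquettesTouching Λ, min 4 (1024 * Real.sqrt 2 * Real.exp (-(starRate 4 (gaugeR (2 * b)) * ⌊m p / (4 : ℕ)⌋₊))) +
        4 * b * ((plaquettesTouching Λ).filter fun p => ¬plaquetteEdges p ⊆ Λ).card := by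
  classical
  have hρc : Continuous (fundamentalRep (Fin 2)) := continuous_fundamentalRep (Fin 2)
  have hGibbs : IsGibbsMeasure (ymSpecification (d := 4) (fundamentalRep (Fin 2)) b) μ := hμ
  haveI := hGibbs.isProbabilityMeasure
  set T := plaquettesTouching Λ with hTdef
  set S : ℝ := ∑ p ∈ T, min 4 (1024 * Real.sqrt 2 * Real.exp (-(starRate 4 (gaugeR (2 * b)) * ⌊m p / (4 : ℕ)⌋₊))) with hS
  set D : ℝ := ((T.filter fun p => ¬plaquetteEdges p ⊆ Λ).card : ℝ) with hD
  set u := ∫ U, plaquetteObs (fundamentalRep (Fin 2)) 0 0 1 U ∂μ with hu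
  set f := freeEnergyDensity 4 (fundamentalRep (Fin 2)) b with hf
  set kl := (klDiv (μ.map (fun U (e : ↥Λ) => U e)) (Measure.pi fun _ : ↥Λ => haarProbability (SUN 2))).toReal with hkl
  -- the one state is axis symmetric: all plaquette means agree
  obtain ⟨ν, h1, h2, -, -⟩ := su2_wilson_oneState_symmetric (b := b) (abs_le.2 ⟨by linarith, hb⟩)
  have hμν : μ = ν := by rw [h1] at hμ; exact Set.mem_singleton_iff.1 hμ
  have hνL : ν ∈ infiniteVolumeLimitPoints (d := 4) (fundamentalRep (Fin 2)) b := by rw [h2]; exact Set.mem_singleton _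
  have hplane : ∀ p ∈ T, ∫ U, plaquetteObs (fundamentalRep (Fin 2)) p.1 p.2.1.1 p.2.1.2 U ∂μ = u := fun p _ => by
    rw [hu, hμν]; exact PlaquettePositivity.integral_plaquetteObs_eq (fundamentalRep (Fin 2)) hρc (by norm_num) hνL p.1 (ne_of_lt p.2.2)
  have hsum : ∑ p ∈ T, ((2 : ℝ) - ∫ U, plaquetteObs (fundamentalRep (Fin 2)) p.1 p.2.1.1 p.2.1.2 U ∂μ) = (T.card : ℝ) * (2 - u) := by
    rw [Finset.sum_congr rfl fun p hp => by rw [hplane p hp], Finset.sum_const, nsmul_eq_mul]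
  -- UPPER BOUND: every inner Gibbs law has KL ≤ −b #T (2 − u) − (#T/6) f + 2 b S; Jensen under the DLR mixture
  have hup : kl ≤ -b * (T.card * (2 - u)) - T.card / 6 * f + 2 * b * S := by
    refine (toReal_klDiv_map_restrict_le (fundamentalRep (Fin 2)) hρc b Λ hμ fun η => ?_).2
    have h := su2_abs_klDiv_inner_law_haar_sub_le hb0 hb hμ Λ η φ hφ hφΛ m hm
    rw [← hTdef] at h
    rw [hsum, ← hS, ← hf, abs_le] at h
    linarith [h.2]
  -- LOWER BOUND: the variational inequality at the auxiliary boundary field `1`, «C-DS-I» for `log Z`, and the glued-restricted energy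
  set η₀ : LGConfig 4 (SUN 2) := fun _ => 1 with hη₀
  have hlow1 := neg_log_normaliser_sub_le_toReal_klDiv_map_restrict (fundamentalRep (Fin 2)) hρc b Λ hμ η₀
  have hZ := su2_abs_log_normaliser_sub_freeEnergy_le hb0 hb Λ η₀ φ hφ hφΛ m hm
  rw [abs_le] at hZ
  have hE : ∫ U, wilsonBoundaryAction (fundamentalRep (Fin 2)) Λ (glueWith Λ (fun e : ↥Λ => U e) η₀) ∂μ ≤ T.card * (2 - u) + 2 * (2 : ℕ) * D := by
    have hSc : Continuous (wilsonBoundaryAction (G := SUN 2) (fundamentalRep (Fin 2)) Λ) := continuous_wilsonBoundaryAction _ hρc Λ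
    obtain ⟨C, hC⟩ := exists_bound_of_continuous hSc
    have hr : Measurable fun (U : LGConfig 4 (SUN 2)) (e : ↥Λ) => U e := measurable_pi_lambda _ fun e => measurable_pi_apply _
    have hi1 : Integrable (fun U : LGConfig 4 (SUN 2) => wilsonBoundaryAction (fundamentalRep (Fin 2)) Λ (glueWith Λ (fun e : ↥Λ => U e) η₀)) μ :=
      integrable_of_bound ((hSc.measurable.comp ((measurable_glueWith Λ η₀).comp hr)).aestronglyMeasurable) (C := C) fun U => hC _
    have hi2 : Integrable (fun U : LGConfig 4 (SUN 2) => wilsonBoundaryAction (fundamentalRep (Fin 2)) Λ U + 2 * (2 : ℕ) * D) μ :=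
      (integrable_of_bound hSc.measurable.aestronglyMeasurable (C := C) fun U => hC U).add (integrable_const _)
    have hmono := integral_mono hi1 hi2 fun U => by
      have h := suN_abs_action_glue_restrict_sub_le (N := 2) Λ U η₀
      rw [abs_le] at h
      show wilsonBoundaryAction (fundamentalRep (Fin 2)) Λ (glueWith Λ (fun e : ↥Λ => U e) η₀) ≤
        wilsonBoundaryAction (fundamentalRep (Fin 2)) Λ U + 2 * (2 : ℕ) * D
      linarith [h.2]
    rw [integral_add (integrable_of_bound hSc.measurable.aestronglyMeasurable (C := C) fun U => hC U) (integrable_const _), integral_const,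
      smul_eq_mul, Measure.real, measure_univ, ENNReal.toReal_one, one_mul, suN_integral_wilsonBoundaryAction_eq_sum] at hmono
    push_cast at hmono hsum ⊢
    rw [hsum] at hmono
    exact hmono
  have hbE := mul_le_mul_of_nonneg_left hE hb0
  rw [abs_le]
  constructor
  · push_cast at hbE
    nlinarith [hlow1, hZ.2, hbE]
  · nlinarith [hup]

/-- ★★ **VAN HOVE FORM, ARBITRARY SHAPES** (`T(Λ) ≠ ∅`, depth budget `K ≥ 1`): with `h(b) = −b(2 − u(b)) − f(b)/6` the relative entropy density,
`|KL(μ|_Λ ‖ Haar_Λ)/#T(Λ) − h(b)| ≤ 2b·(1024√2·e^{−κ₁(R_G(2b))K} + 6·#{p ∈ T(Λ) : m_p < 4K}/#T(Λ))`. [folklore] -/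
theorem su2_abs_klDiv_state_restrict_div_sub_le_of_depth {b : ℝ} (hb0 : 0 ≤ b) (hb : b ≤ 9 / 50)
    {μ : Measure (LGConfig 4 (SUN 2))} (hμ : μ ∈ ymGibbsMeasures (d := 4) (fundamentalRep (Fin 2)) b)
    (Λ : Finset (ZdEdge 4)) (hT : (plaquettesTouching Λ).Nonempty) (φ : ZdEdge 4 → ℝ) (hφ : ∀ x y : ZdEdge 4, φ x ≤ φ y + ‖x.1 - y.1‖)
    (hφΛ : ∀ x, 0 < φ x → x ∈ Λ) (m : ZdPlaquette 4 → ℝ) (hm : ∀ p ∈ plaquettesTouching Λ, ∀ x ∈ plaquetteEdges p, m p ≤ φ x)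
    {K : ℕ} (hK : 1 ≤ K) :
    |(klDiv (μ.map (fun U (e : ↥Λ) => U e)) (Measure.pi fun _ : ↥Λ => haarProbability (SUN 2))).toReal / (plaquettesTouching Λ).card -
        (-b * ((2 : ℝ) - ∫ U, plaquetteObs (fundamentalRep (Fin 2)) 0 0 1 U ∂μ) - freeEnergyDensity 4 (fundamentalRep (Fin 2)) b / 6)| ≤
      2 * b * (1024 * Real.sqrt 2 * Real.exp (-(starRate 4 (gaugeR (2 * b)) * K)) +
        6 * ((plaquettesTouching Λ).filter fun p => m p < 4 * K).card / (plaquettesTouching Λ).card) := by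
  classical
  set T := plaquettesTouching Λ with hTdef
  set κ : ℝ := starRate 4 (gaugeR (2 * b)) with hκ
  set C : ℝ := 1024 * Real.sqrt 2 with hC
  have hC0 : 0 ≤ C := by positivity
  have hκ0 : 0 ≤ κ := (starRate_pos (gaugeR_nonneg (by linarith) (by linarith)) (gaugeR_lt_one_of_le (by linarith) (by linarith))).le
  have hTpos : (0 : ℝ) < (T.card : ℝ) := by exact_mod_cast Finset.card_pos.2 hT
  have hmain := su2_abs_klDiv_state_restrict_sub_le hb0 hb hμ Λ φ hφ hφΛ m hm
  have hS := surface_sum_le_of_depth hκ0 hC0 T m K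
  have hD : (((T.filter fun p => ¬plaquetteEdges p ⊆ Λ).card : ℕ) : ℝ) ≤ ((T.filter fun p => m p < 4 * K).card : ℝ) := by
    exact_mod_cast card_boundaryPlaquettes_le_card_shallow Λ φ hφΛ m hm hK
  set kl := (klDiv (μ.map (fun U (e : ↥Λ) => U e)) (Measure.pi fun _ : ↥Λ => haarProbability (SUN 2))).toReal with hkl
  set h := -b * ((2 : ℝ) - ∫ U, plaquetteObs (fundamentalRep (Fin 2)) 0 0 1 U ∂μ) - freeEnergyDensity 4 (fundamentalRep (Fin 2)) b / 6 with hh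
  rw [show kl / (T.card : ℝ) - h = (kl - (T.card : ℝ) * h) / (T.card : ℝ) by field_simp, abs_div, abs_of_pos hTpos, div_le_iff₀ hTpos]
  refine hmain.trans ?_
  have e : 2 * b * (C * Real.exp (-(κ * K)) + 6 * ((T.filter fun p => m p < 4 * K).card : ℝ) / T.card) * T.card =
      2 * b * (C * Real.exp (-(κ * K)) * T.card + 4 * (T.filter fun p => m p < 4 * K).card) +
        4 * b * (T.filter fun p => m p < 4 * K).card := by
    field_simp
    ring
  rw [e]
  have hb4 : 0 ≤ 4 * b := by linarith
  exact add_le_add (mul_le_mul_of_nonneg_left hS (by linarith)) (mul_le_mul_of_nonneg_left hD hb4)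

/-- ★★★ **THE SPECIFIC RELATIVE ENTROPY OF THE INFINITE-VOLUME YANG–MILLS STATE EXISTS ALONG EVERY VAN HOVE SEQUENCE AND EQUALS
`−b(2 − u(b)) − f(b)/6`** (`SU(2)`, `d = 4`, EVERY `0 ≤ β_W ≤ 9/25`; van Hove sequence with depth data as in `BoundaryVanHoveLimit`):
`KL(μ|_{Λ_n} ‖ Haar_{Λ_n})/#T(Λ_n) → −b(2 − u(b)) − f(b)/6` — i.e. the specific entropy relative to Haar is `s = b·e + p`, `e = 2 − u(b)` the mean
plaquette energy, `p = f(b)/6` the pressure per plaquette, for THE DLR state. [folklore] -/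
theorem su2_klDiv_state_restrict_div_vanHove_tendsto {b : ℝ} (hb0 : 0 ≤ b) (hb : b ≤ 9 / 50)
    {μ : Measure (LGConfig 4 (SUN 2))} (hμ : μ ∈ ymGibbsMeasures (d := 4) (fundamentalRep (Fin 2)) b)
    (Λ : ℕ → Finset (ZdEdge 4)) (hT : ∀ n, (plaquettesTouching (Λ n)).Nonempty)
    (φ : ℕ → ZdEdge 4 → ℝ) (hφ : ∀ n (x y : ZdEdge 4), φ n x ≤ φ n y + ‖x.1 - y.1‖) (hφΛ : ∀ n x, 0 < φ n x → x ∈ Λ n)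
    (m : ℕ → ZdPlaquette 4 → ℝ) (hm : ∀ n, ∀ p ∈ plaquettesTouching (Λ n), ∀ x ∈ plaquetteEdges p, m n p ≤ φ n x)
    (hvH : ∀ K : ℕ, Tendsto (fun n => ((((plaquettesTouching (Λ n)).filter fun p => m n p < 4 * K).card : ℝ)) /
      (plaquettesTouching (Λ n)).card) atTop (𝓝 0)) :
    Tendsto (fun n => (klDiv ((μ.map (fun U (e : ↥(Λ n)) => U e))) (Measure.pi fun _ : ↥(Λ n) => haarProbability (SUN 2))).toReal /
        (plaquettesTouching (Λ n)).card) atTop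
      (𝓝 (-b * ((2 : ℝ) - ∫ U, plaquetteObs (fundamentalRep (Fin 2)) 0 0 1 U ∂μ) - freeEnergyDensity 4 (fundamentalRep (Fin 2)) b / 6)) := by
  rw [Metric.tendsto_atTop]
  intro ε hε
  have hκ : 0 < starRate 4 (gaugeR (2 * b)) :=
    starRate_pos (gaugeR_nonneg (by linarith) (by linarith)) (gaugeR_lt_one_of_le (by linarith) (by linarith))
  -- budget `K + 1 ≥ 1`: `2b (C e^{−κK} + 4 · (3/2) s_n(K+1)) ≤ ε/2`
  obtain ⟨K, n₀, hKn⟩ := exists_budget_of_vanHove hκ (2 * b) (1024 * Real.sqrt 2)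
    (fun n K => 3 / 2 * (((((plaquettesTouching (Λ n)).filter fun p => m n p < 4 * ((K + 1 : ℕ) : ℝ)).card : ℝ)) /
      (plaquettesTouching (Λ n)).card)) (fun K => by simpa using (hvH (K + 1)).const_mul (3 / 2 : ℝ)) (show (0 : ℝ) < ε / 2 by linarith)
  refine ⟨n₀, fun n hn => ?_⟩
  rw [Real.dist_eq]
  have hest := su2_abs_klDiv_state_restrict_div_sub_le_of_depth hb0 hb hμ (Λ n) (hT n) (φ n) (hφ n) (hφΛ n) (m n) (hm n)
    (K := K + 1) (by omega)
  have hexp : Real.exp (-(starRate 4 (gaugeR (2 * b)) * ((K + 1 : ℕ) : ℝ))) ≤ Real.exp (-(starRate 4 (gaugeR (2 * b)) * K)) :=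
    Real.exp_le_exp.2 (by push_cast; nlinarith)
  have h2b : 0 ≤ 2 * b := by linarith
  have hK' := hKn n hn
  have hcmp : 2 * b * (1024 * Real.sqrt 2 * Real.exp (-(starRate 4 (gaugeR (2 * b)) * ((K + 1 : ℕ) : ℝ))) +
      6 * ((((plaquettesTouching (Λ n)).filter fun p => m n p < 4 * ((K + 1 : ℕ) : ℝ)).card : ℝ)) / (plaquettesTouching (Λ n)).card) ≤
      2 * b * (1024 * Real.sqrt 2 * Real.exp (-(starRate 4 (gaugeR (2 * b)) * K)) +
        4 * (3 / 2 * (((((plaquettesTouching (Λ n)).filter fun p => m n p < 4 * ((K + 1 : ℕ) : ℝ)).card : ℝ)) /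
          (plaquettesTouching (Λ n)).card))) := by
    refine mul_le_mul_of_nonneg_left ?_ h2b
    have hC0 : (0 : ℝ) ≤ 1024 * Real.sqrt 2 := by positivity
    rw [show (6 : ℝ) * ((((plaquettesTouching (Λ n)).filter fun p => m n p < 4 * ((K + 1 : ℕ) : ℝ)).card : ℝ)) /
        (plaquettesTouching (Λ n)).card = 4 * (3 / 2 * (((((plaquettesTouching (Λ n)).filter fun p =>
          m n p < 4 * ((K + 1 : ℕ) : ℝ)).card : ℝ)) / (plaquettesTouching (Λ n)).card)) by ring]
    exact add_le_add_left (mul_le_mul_of_nonneg_left hexp hC0) _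
  have hfin := hest.trans (hcmp.trans hK')
  linarith

/-- ★★★ **THE INFINITE-VOLUME STATE IS CLOSE TO EVERY INNER GIBBS LAW IN RELATIVE ENTROPY — A PURE SURFACE COST** (`SU(2)`, `d = 4`, tree coupling
`0 ≤ b ≤ 9/50`; `μ` THE DLR state at `b`; finite `Λ` with depth data `(φ, m)`; EVERY boundary field `η`):
`KL(μ|_Λ ‖ π_Λ^{b,η}) ≤ 3b·Σ_{p∈T(Λ)} min 4 (1024√2·e^{−κ₁(R_G(2b))⌊m_p/4⌋}) + 4b·#∂T(Λ)` — NO volume term: the three volume-order quantities (entropy of the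
marginal, its energy against `η`, the free energy with boundary field `η`) cancel exactly; so the SPECIFIC relative entropy of THE state with respect to
the finite-volume Gibbs laws with ANY boundary conditions vanishes — the "information gain zero" half of the Lanford–Ruelle variational principle,
in quantitative surface form. [folklore] -/
theorem su2_toReal_klDiv_state_restrict_inner_law_le {b : ℝ} (hb0 : 0 ≤ b) (hb : b ≤ 9 / 50)
    {μ : Measure (LGConfig 4 (SUN 2))} (hμ : μ ∈ ymGibbsMeasures (d := 4) (fundamentalRep (Fin 2)) b)
    (Λ : Finset (ZdEdge 4)) (η : LGConfig 4 (SUN 2)) (φ : ZdEdge 4 → ℝ) (hφ : ∀ x y : ZdEdge 4, φ x ≤ φ y + ‖x.1 - y.1‖)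
    (hφΛ : ∀ x, 0 < φ x → x ∈ Λ) (m : ZdPlaquette 4 → ℝ) (hm : ∀ p ∈ plaquettesTouching Λ, ∀ x ∈ plaquetteEdges p, m p ≤ φ x) :
    klDiv (μ.map (fun U (e : ↥Λ) => U e)) ((Measure.pi fun _ : ↥Λ => haarProbability (SUN 2)).tilted
        (fun ζ => -b * wilsonBoundaryAction (fundamentalRep (Fin 2)) Λ (glueWith Λ ζ η))) ≠ ∞ ∧
    (klDiv (μ.map (fun U (e : ↥Λ) => U e)) ((Measure.pi fun _ : ↥Λ => haarProbability (SUN 2)).tilted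
        (fun ζ => -b * wilsonBoundaryAction (fundamentalRep (Fin 2)) Λ (glueWith Λ ζ η)))).toReal ≤
      3 * b * ∑ p ∈ plaquettesTouching Λ, min 4 (1024 * Real.sqrt 2 * Real.exp (-(starRate 4 (gaugeR (2 * b)) * ⌊m p / (4 : ℕ)⌋₊))) +
        4 * b * ((plaquettesTouching Λ).filter fun p => ¬plaquetteEdges p ⊆ Λ).card := by
  classical
  have hρc : Continuous (fundamentalRep (Fin 2)) := continuous_fundamentalRep (Fin 2)
  have hGibbs : IsGibbsMeasure (ymSpecification (d := 4) (fundamentalRep (Fin 2)) b) μ := hμ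
  haveI := hGibbs.isProbabilityMeasure
  have hr : Measurable fun (U : LGConfig 4 (SUN 2)) (e : ↥Λ) => U e := measurable_pi_lambda _ fun e => measurable_pi_apply _
  haveI : IsProbabilityMeasure (μ.map (fun U (e : ↥Λ) => U e)) := Measure.isProbabilityMeasure_map hr.aemeasurable
  set H : Measure (↥Λ → SUN 2) := Measure.pi fun _ : ↥Λ => haarProbability (SUN 2) with hH
  haveI : IsProbabilityMeasure H := by rw [hH]; infer_instance
  set T := plaquettesTouching Λ with hTdef
  set S : ℝ := ∑ p ∈ T, min 4 (1024 * Real.sqrt 2 * Real.exp (-(starRate 4 (gaugeR (2 * b)) * ⌊m p / (4 : ℕ)⌋₊))) with hS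
  set D : ℝ := ((T.filter fun p => ¬plaquetteEdges p ⊆ Λ).card : ℝ) with hD
  set u := ∫ U, plaquetteObs (fundamentalRep (Fin 2)) 0 0 1 U ∂μ with hu
  set f := freeEnergyDensity 4 (fundamentalRep (Fin 2)) b with hf
  obtain ⟨hac, hint⟩ := map_restrict_ac_integrable_llr (fundamentalRep (Fin 2)) hρc b Λ hμ
  -- the identity KL(μ_Λ ‖ π^η) = KL(μ_Λ ‖ H) + b ∫ S(· ⊕ η) dμ_Λ + log Z(η)
  have hid := toReal_klDiv_inner_law_eq (fundamentalRep (Fin 2)) hρc b Λ η (μ.map (fun U (e : ↥Λ) => U e)) hac hint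
  have hexpH : Integrable (fun ζ => Real.exp (-b * wilsonBoundaryAction (fundamentalRep (Fin 2)) Λ (glueWith Λ ζ η))) H :=
    integrable_exp_neg_mul_action_glueWith (fundamentalRep (Fin 2)) hρc b Λ η H
  have hSc : Continuous (wilsonBoundaryAction (G := SUN 2) (fundamentalRep (Fin 2)) Λ) := continuous_wilsonBoundaryAction _ hρc Λ
  obtain ⟨C, hC⟩ := exists_bound_of_continuous hSc
  -- finiteness: the marginal is absolutely continuous w.r.t. the inner law with integrable llr
  have hfm : Measurable fun ζ : ↥Λ → SUN 2 => -b * wilsonBoundaryAction (fundamentalRep (Fin 2)) Λ (glueWith Λ ζ η) :=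
    (hSc.measurable.comp (measurable_glueWith Λ η)).const_mul _
  have hne : klDiv (μ.map (fun U (e : ↥Λ) => U e)) (H.tilted fun ζ => -b * wilsonBoundaryAction (fundamentalRep (Fin 2)) Λ (glueWith Λ ζ η)) ≠ ∞ := by
    refine klDiv_ne_top (hac.trans (absolutelyContinuous_tilted hexpH)) ?_
    refine integrable_llr_tilted_right hac (integrable_of_bound hfm.aestronglyMeasurable (C := |b| * C) fun ζ => ?_) hint hexpH
    rw [abs_mul, abs_neg]; exact mul_le_mul_of_nonneg_left (hC _) (abs_nonneg b)
  refine ⟨hne, ?_⟩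
  -- the one state is axis symmetric: all plaquette means agree
  obtain ⟨ν, h1, h2, -, -⟩ := su2_wilson_oneState_symmetric (b := b) (abs_le.2 ⟨by linarith, hb⟩)
  have hμν : μ = ν := by rw [h1] at hμ; exact Set.mem_singleton_iff.1 hμ
  have hνL : ν ∈ infiniteVolumeLimitPoints (d := 4) (fundamentalRep (Fin 2)) b := by rw [h2]; exact Set.mem_singleton _
  have hplane : ∀ p ∈ T, ∫ U, plaquetteObs (fundamentalRep (Fin 2)) p.1 p.2.1.1 p.2.1.2 U ∂μ = u := fun p _ => by
    rw [hu, hμν]; exact PlaquettePositivity.integral_plaquetteObs_eq (fundamentalRep (Fin 2)) hρc (by norm_num) hνL p.1 (ne_of_lt p.2.2)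
  have hsum : ∑ p ∈ T, ((2 : ℝ) - ∫ U, plaquetteObs (fundamentalRep (Fin 2)) p.1 p.2.1.1 p.2.1.2 U ∂μ) = (T.card : ℝ) * (2 - u) := by
    rw [Finset.sum_congr rfl fun p hp => by rw [hplane p hp], Finset.sum_const, nsmul_eq_mul]
  -- (1) KL(μ_Λ ‖ H) ≤ −b #T (2 − u) − (#T/6) f + 2 b S (Jensen + «C-DS-I» entropy form)
  have hup : (klDiv (μ.map (fun U (e : ↥Λ) => U e)) H).toReal ≤ -b * (T.card * (2 - u)) - T.card / 6 * f + 2 * b * S := by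
    refine (toReal_klDiv_map_restrict_le (fundamentalRep (Fin 2)) hρc b Λ hμ fun η' => ?_).2
    have h := su2_abs_klDiv_inner_law_haar_sub_le hb0 hb hμ Λ η' φ hφ hφΛ m hm
    rw [← hTdef] at h
    rw [hsum, ← hS, ← hf, abs_le] at h
    linarith [h.2]
  -- (2) the energy against `η`: ∫ S(· ⊕ η) dμ_Λ ≤ #T (2 − u) + 4 D
  have hE : ∫ ζ, wilsonBoundaryAction (fundamentalRep (Fin 2)) Λ (glueWith Λ ζ η) ∂(μ.map (fun U (e : ↥Λ) => U e)) ≤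
      T.card * (2 - u) + 2 * (2 : ℕ) * D := by
    have hmap : ∫ ζ, wilsonBoundaryAction (fundamentalRep (Fin 2)) Λ (glueWith Λ ζ η) ∂(μ.map (fun U (e : ↥Λ) => U e)) =
        ∫ U, wilsonBoundaryAction (fundamentalRep (Fin 2)) Λ (glueWith Λ (fun e : ↥Λ => U e) η) ∂μ :=
      integral_map hr.aemeasurable ((hSc.measurable.comp (measurable_glueWith Λ η)).aestronglyMeasurable)
    rw [hmap]
    have hi1 : Integrable (fun U : LGConfig 4 (SUN 2) => wilsonBoundaryAction (fundamentalRep (Fin 2)) Λ (glueWith Λ (fun e : ↥Λ => U e) η)) μ :=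
      integrable_of_bound ((hSc.measurable.comp ((measurable_glueWith Λ η).comp hr)).aestronglyMeasurable) (C := C) fun U => hC _
    have hi2 : Integrable (fun U : LGConfig 4 (SUN 2) => wilsonBoundaryAction (fundamentalRep (Fin 2)) Λ U + 2 * (2 : ℕ) * D) μ :=
      (integrable_of_bound hSc.measurable.aestronglyMeasurable (C := C) fun U => hC U).add (integrable_const _)
    have hmono := integral_mono hi1 hi2 fun U => by
      have h := suN_abs_action_glue_restrict_sub_le (N := 2) Λ U η
      rw [abs_le] at h
      show wilsonBoundaryAction (fundamentalRep (Fin 2)) Λ (glueWith Λ (fun e : ↥Λ => U e) η) ≤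
        wilsonBoundaryAction (fundamentalRep (Fin 2)) Λ U + 2 * (2 : ℕ) * D
      linarith [h.2]
    rw [integral_add (integrable_of_bound hSc.measurable.aestronglyMeasurable (C := C) fun U => hC U) (integrable_const _), integral_const,
      smul_eq_mul, Measure.real, measure_univ, ENNReal.toReal_one, one_mul, suN_integral_wilsonBoundaryAction_eq_sum] at hmono
    push_cast at hmono hsum ⊢
    rw [hsum] at hmono
    exact hmono
  -- (3) log Z(η) ≤ (#T/6) f + b S («C-DS-I»)
  have hZ := su2_abs_log_normaliser_sub_freeEnergy_le hb0 hb Λ η φ hφ hφΛ m hm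
  rw [← hTdef] at hZ
  rw [← hS, ← hf, abs_le] at hZ
  have hbE := mul_le_mul_of_nonneg_left hE hb0
  rw [hid]
  push_cast at hbE ⊢
  nlinarith [hup, hbE, hZ.2]

/-- ★★★ **… hence the SPECIFIC relative entropy of THE state w.r.t. the inner Gibbs laws VANISHES along every van Hove sequence, for EVERY sequence of
boundary fields** (`K ≥ 1` form per plaquette): `KL(μ|_Λ ‖ π_Λ^{b,η})/#T(Λ) ≤ b·(3·1024√2·e^{−κ₁(R_G(2b))K} + 16·#{p ∈ T(Λ) : m_p < 4K}/#T(Λ))`.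
[folklore] -/
theorem su2_toReal_klDiv_state_restrict_inner_law_div_le_of_depth {b : ℝ} (hb0 : 0 ≤ b) (hb : b ≤ 9 / 50)
    {μ : Measure (LGConfig 4 (SUN 2))} (hμ : μ ∈ ymGibbsMeasures (d := 4) (fundamentalRep (Fin 2)) b)
    (Λ : Finset (ZdEdge 4)) (hT : (plaquettesTouching Λ).Nonempty) (η : LGConfig 4 (SUN 2)) (φ : ZdEdge 4 → ℝ)
    (hφ : ∀ x y : ZdEdge 4, φ x ≤ φ y + ‖x.1 - y.1‖) (hφΛ : ∀ x, 0 < φ x → x ∈ Λ)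
    (m : ZdPlaquette 4 → ℝ) (hm : ∀ p ∈ plaquettesTouching Λ, ∀ x ∈ plaquetteEdges p, m p ≤ φ x) {K : ℕ} (hK : 1 ≤ K) :
    (klDiv (μ.map (fun U (e : ↥Λ) => U e)) ((Measure.pi fun _ : ↥Λ => haarProbability (SUN 2)).tilted
        (fun ζ => -b * wilsonBoundaryAction (fundamentalRep (Fin 2)) Λ (glueWith Λ ζ η)))).toReal / (plaquettesTouching Λ).card ≤
      b * (3 * (1024 * Real.sqrt 2) * Real.exp (-(starRate 4 (gaugeR (2 * b)) * K)) +
        16 * ((plaquettesTouching Λ).filter fun p => m p < 4 * K).card / (plaquettesTouching Λ).card) := by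
  classical
  set T := plaquettesTouching Λ with hTdef
  set κ : ℝ := starRate 4 (gaugeR (2 * b)) with hκ
  set C : ℝ := 1024 * Real.sqrt 2 with hC
  have hC0 : 0 ≤ C := by positivity
  have hκ0 : 0 ≤ κ := (starRate_pos (gaugeR_nonneg (by linarith) (by linarith)) (gaugeR_lt_one_of_le (by linarith) (by linarith))).le
  have hTpos : (0 : ℝ) < (T.card : ℝ) := by exact_mod_cast Finset.card_pos.2 hT
  have hmain := (su2_toReal_klDiv_state_restrict_inner_law_le hb0 hb hμ Λ η φ hφ hφΛ m hm).2
  have hS := surface_sum_le_of_depth hκ0 hC0 T m K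
  have hD : (((T.filter fun p => ¬plaquetteEdges p ⊆ Λ).card : ℕ) : ℝ) ≤ ((T.filter fun p => m p < 4 * K).card : ℝ) := by
    exact_mod_cast card_boundaryPlaquettes_le_card_shallow Λ φ hφΛ m hm hK
  rw [div_le_iff₀ hTpos]
  refine hmain.trans ?_
  have e : b * (3 * C * Real.exp (-(κ * K)) + 16 * ((T.filter fun p => m p < 4 * K).card : ℝ) / T.card) * T.card =
      3 * b * (C * Real.exp (-(κ * K)) * T.card + 4 * (T.filter fun p => m p < 4 * K).card) +
        4 * b * (T.filter fun p => m p < 4 * K).card := by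
    field_simp
    ring
  rw [e]
  have hb3 : 0 ≤ 3 * b := by linarith
  have hb4 : 0 ≤ 4 * b := by linarith
  exact add_le_add (mul_le_mul_of_nonneg_left hS hb3) (mul_le_mul_of_nonneg_left hD hb4)

end SU2

end BoundaryFreeEnergy

end Summit.Ventures.YMGap.RobustBall

end
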